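import Mathlib.RingTheory.OrderOfVanishing.Basic
import Literature.Algebra.Module.PairedTorsionModulesAlternating
import Literature.Algebra.Module.DVRModuleType
import Literature.GroupTheory.FiniteAbelian.AlternatingPairing
import HarnessLib

/-!
# Symplectic torsion modules over a discrete valuation ring: a non-degenerate alternating form forces
# `N ≅ M ⊕ M` (Howard 2004, Lemma 1.5.7: «`𝓗^ℓ(n)/(𝓗(n) + 𝓗(ℓn)) ≅ D ⊕ D`»)

Topic `Algebra/Module`; namespace `Literature.Algebra.Module` (sequel to x10b-p1-w7's
`PairedTorsionModulesDVR.lean` / `PairedTorsionModulesAlternating.lean` and to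
`TorsionLayerSymplecticParity.lean`). THEOREMS ONLY: no definition, no named fact, no instance, no `sorry`.
Cell `pub/bsd-print-x9`, print leaf G87 `Literature.NumberTheory.GaloisCohomology.Howard2004.thm161_dvrKolyvaginBound`
(Howard 2004 Thm. 1.6.1): after the 2026-08-29 bricks the leaf is reduced in the kernel to Howard's Prop. 1.4.1
and Lemma 1.6.4; Lemma 1.6.4 rests on §1.5 (Lemmas 1.5.6–1.5.8, Prop. 1.5.9), whose one purely
module-theoretic sentence is the symplectic structure theorem used in Lemma 1.5.7 — proved here over a
general discrete valuation ring.

SOURCE, verbatim. B. Howard, *The Heegner point Kolyvagin system*, Compositio Math. **140** (2004) 1439–1472,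
Lemma 1.5.7 (= arXiv:1202.6340 Lemma 2.5.7, held text p0010 L105–L139): «For some `δ ≥ 0`,
`𝓗^ℓ(n)/(𝓗(n)+𝓗(ℓn)) ≅ (R/𝔪^δ)²`. *Proof.* We first construct a non-degenerate, alternating, `R`-bilinear,
`R`-valued pairing on the module `𝓗^ℓ(n)/(𝓗(n)+𝓗(ℓn))`. […] We now have that
`𝓗^ℓ(n)/(𝓗(n)+𝓗(ℓn)) ≅ D ⊕ D` for some `R`-module `D`. Since […] can be generated by two elements […]
`D` is cyclic.» Here `R` is a principal Artinian local ring of length `k`, i.e. `R/(ϖᵏ)` for a discrete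
valuation ring with uniformiser `ϖ`; an `R`-module is a module killed by `ϖᵏ`, and «`R`-valued» means
`R/(ϖᵏ)`-valued. The sentence «We now have … `≅ D ⊕ D`» is the classical structure theorem for symplectic
torsion modules (for abelian groups: a finite abelian group with a non-degenerate alternating pairing is
`≅ M × M`; the tree's `GroupTheory/FiniteAbelian/AlternatingPairing.lean` and
`Algebra/Module/AlternatingPairingParity.lean` prove only the parity / square-order shadow of it and say so).

WHAT IS PROVED (for `R` a DVR with uniformiser `ϖ`, `N` finitely generated with `ϖᵏN = 0`, `B : N × N → P`
`R`-bilinear, ALTERNATING, with trivial radical, `P` any `R`-module whose `ϖ`-torsion is cyclic — e.g.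
`P = R/(ϖᵃ)`, Howard's `R`, by `exists_eq_smul_of_smul_eq_zero_quotient_uniformizer_pow`):
* `forall_socle_apply_eq_zero_iff` — **socle orthogonality**: `w ⟂ (ϖʲN ∩ N[ϖ]) ↔ w ∈ N[ϖʲ] + ϖN`
  (the orthogonal of the `j`-th Ulm–Kaplansky socle is `N[ϖʲ] + ϖN`; for `j = 0`: `N[ϖ]^⟂ = ϖN`, the
  DVR form of `FiniteAbelian.AlternatingPairing.mem_range_nsmul_of_forall_torsionBy`). Proof: the induced
  pairing `(ϖʲN)[ϖ] × N/(N[ϖʲ] + ϖN) → P[ϖ] ≅ R/(ϖ)` of `R/(ϖ)`-vector spaces is left-non-degenerate and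
  the two spaces have the same dimension — `N/(N[ϖʲ]+ϖN) ≅ ϖʲN/ϖ^{j+1}N` (`nonempty_quotient_torsionBy_sup_smul_top_linearEquiv`)
  and `ℓ(X[ϖ]) = ℓ(X/ϖX)` for `X = ϖʲN` of finite length (`length_torsionBy_eq_length_quotient_smul_top`,
  additivity of length along `0 → X[ϖ] → X → ϖX → 0`) — so it is right-non-degenerate
  (`FiniteAbelian.separatingRight_of_separatingLeft_of_finrank_eq`).
* `exists_linearEquiv_pi_prod_self_of_isAlt_of_nondegenerate` — **the symplectic structure theorem**
  («`≅ D ⊕ D`»): `N ≃ₗ[R] (Π_j R/(ϖ^{n_j})) × (Π_j R/(ϖ^{n_j}))` with `1 ≤ n_j ≤ k`. Proof: the single form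
  induces the LAYERED forms `B_t(x, y) = B(ϖᵗx, y)` on `N[ϖ^{t+1}]` (every `t`), alternating, with radical
  exactly `N[ϖᵗ] + ϖN[ϖ^{t+2}]` by socle orthogonality; x10b-p1-w7's Thm. 1.4.2 algebraic half
  (`exists_linearEquiv_pi_prod_pi_prod_self_of_isAlt`, applied with `k + 1`) gives
  `N ≅ (R/(ϖ^{k+1}))^ε × M × M`, and `ϖᵏN = 0` forces `ε = 0`, `n_j ≤ k`.
* `exists_linearEquiv_pi_prod_self_of_isAlt_quotient_uniformizer_pow` (values in `R/(ϖᵃ)`, Howard's case),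
  `even_length_of_isAlt_of_nondegenerate` (`N ≅ M × M`, `ℓ(N) = 2ℓ(M)`), `length_ne_top_of_pow_smul_eq_zero`.

NOT HERE: «`D` is cyclic» (the two-generator remark), Lemma 1.5.6 / the maximal-isotropy input, global
duality, and anything Galois-cohomological; `thm161_dvrKolyvaginBound` is NOT proved by this file.
References: [Howard2004HeegnerKolyvagin] Lemma 1.5.7; [Kaplansky1954] §11 (socles `P_n = pⁿM ∩ M[p]`).
-/

noncomputable section

open Module Submodule
open scoped Pointwise

namespace Literature.Algebra.Module

universe u v

/-! ### §1 `N/(N[ϖʲ] + ϖN) ≅ ϖʲN/ϖ^{j+1}N`, and `ℓ(X[ϖ]) = ℓ(X/ϖX)` for `X` of finite length -/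

section CommRing

variable {R : Type u} [CommRing R] {N : Type v} [AddCommGroup N] [Module R N]

/-- `N/(N[ϖʲ] + ϖN) ≅ ϖʲN/ϖ·ϖʲN` via `w ↦ ϖʲw` (any commutative ring): the map `w ↦ ϖʲ w` is onto `ϖʲN`,
and `ϖʲw ∈ ϖ^{j+1}N` iff `w ∈ N[ϖʲ] + ϖN` (if `ϖʲw = ϖ^{j+1}u` then `w − ϖu ∈ N[ϖʲ]`). This is the
bookkeeping «`𝓗[𝔪ˢ]/𝔪𝓗[𝔪^{s+1}]`»-type identification behind the socle layers.
[cite: Kaplansky1954, §11 (PDF pp. 29–30: the socles `P_n = pⁿM ∩ M[p]` and `pⁿM/p^{n+1}M`)] -/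
theorem nonempty_quotient_torsionBy_sup_smul_top_linearEquiv (ϖ : R) (j : ℕ) :
    Nonempty ((N ⧸ (torsionBy R N (ϖ ^ j) ⊔ ϖ • (⊤ : Submodule R N))) ≃ₗ[R]
      (↥(ϖ ^ j • (⊤ : Submodule R N)) ⧸ (ϖ • (⊤ : Submodule R ↥(ϖ ^ j • (⊤ : Submodule R N)))))) := by
  -- `Φ : N → ϖ^j N`, `w ↦ ϖ^j w`
  let Φ : N →ₗ[R] ↥(ϖ ^ j • (⊤ : Submodule R N)) :=
    LinearMap.codRestrict _ (DistribSMul.toLinearMap R N (ϖ ^ j)) fun w =>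
      Submodule.smul_mem_pointwise_smul _ _ _ Submodule.mem_top
  have hΦ : ∀ w, ((Φ w : ↥(ϖ ^ j • (⊤ : Submodule R N))) : N) = ϖ ^ j • w := fun w => rfl
  have hΦsurj : Function.Surjective Φ := by
    intro y
    obtain ⟨w, -, hw⟩ := (Submodule.mem_smul_pointwise_iff_exists _ _ _).1 y.2
    exact ⟨w, Subtype.ext (by rw [hΦ, hw])⟩
  let Q : Submodule R ↥(ϖ ^ j • (⊤ : Submodule R N)) := ϖ • ⊤
  have hker : LinearMap.ker (Q.mkQ.comp Φ) = torsionBy R N (ϖ ^ j) ⊔ ϖ • (⊤ : Submodule R N) := by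
    rw [LinearMap.ker_comp, Submodule.ker_mkQ]
    ext w
    rw [Submodule.mem_comap]
    constructor
    · intro hw
      obtain ⟨u, -, hu⟩ := (Submodule.mem_smul_pointwise_iff_exists _ _ _).1 hw
      have hu' : ϖ • ((u : ↥(ϖ ^ j • (⊤ : Submodule R N))) : N) = ϖ ^ j • w := by
        rw [← hΦ w, ← hu]; rfl
      obtain ⟨u₀, -, hu₀⟩ := (Submodule.mem_smul_pointwise_iff_exists _ _ _).1 u.2
      have h1 : w - ϖ • u₀ ∈ torsionBy R N (ϖ ^ j) := by
        rw [mem_torsionBy_iff, smul_sub, ← hu', ← hu₀, smul_comm, sub_self]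
      have h2 : ϖ • u₀ ∈ ϖ • (⊤ : Submodule R N) := Submodule.smul_mem_pointwise_smul _ _ _ Submodule.mem_top
      have h3 := Submodule.add_mem_sup h1 h2
      rwa [sub_add_cancel] at h3
    · intro hw
      obtain ⟨a, ha, b, hb, rfl⟩ := Submodule.mem_sup.1 hw
      obtain ⟨u, -, rfl⟩ := (Submodule.mem_smul_pointwise_iff_exists _ _ _).1 hb
      have : Φ (a + ϖ • u) = ϖ • Φ u := by
        apply Subtype.ext
        rw [hΦ, Submodule.coe_smul, hΦ, smul_add, (mem_torsionBy_iff _ _).1 ha, zero_add, smul_comm]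
      rw [this]
      exact Submodule.smul_mem_pointwise_smul _ _ _ Submodule.mem_top
  exact ⟨(Submodule.quotEquivOfEq _ _ hker.symm).trans
    (LinearMap.quotKerEquivOfSurjective _ ((Submodule.mkQ_surjective Q).comp hΦsurj))⟩

/-- `ℓ(X[ϖ]) = ℓ(X/ϖX)` for a module `X` of finite length over a commutative ring and any `ϖ`: additivity of
length along `0 → X[ϖ] → X → ϖX → 0` and `0 → ϖX → X → X/ϖX → 0` («`dim 𝓗[𝔪] = dim 𝓗/𝔪𝓗`»-type
count; for `X` a direct sum of cyclic modules both numbers are the number of summands).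
[cite: Kaplansky1954, §11 (PDF pp. 29–30)] -/
theorem length_torsionBy_eq_length_quotient_smul_top {X : Type*} [AddCommGroup X] [Module R X]
    (ϖ : R) (hX : Module.length R X ≠ ⊤) :
    Module.length R (torsionBy R X ϖ) = Module.length R (X ⧸ (ϖ • (⊤ : Submodule R X))) := by
  -- `0 → X[ϖ] → X → ϖX → 0` and `0 → ϖX → X → X/ϖX → 0`
  let g : X →ₗ[R] ↥(ϖ • (⊤ : Submodule R X)) :=
    LinearMap.codRestrict _ (DistribSMul.toLinearMap R X ϖ) fun x =>
      Submodule.smul_mem_pointwise_smul _ _ _ Submodule.mem_top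
  have hg : ∀ x, ((g x : ↥(ϖ • (⊤ : Submodule R X))) : X) = ϖ • x := fun x => rfl
  have hgsurj : Function.Surjective g := by
    intro y
    obtain ⟨w, -, hw⟩ := (Submodule.mem_smul_pointwise_iff_exists _ _ _).1 y.2
    exact ⟨w, Subtype.ext (by rw [hg, hw])⟩
  have hexact : Function.Exact (torsionBy R X ϖ).subtype g := by
    intro x
    constructor
    · intro hx
      refine ⟨⟨x, (mem_torsionBy_iff _ _).2 ?_⟩, rfl⟩
      have h := congrArg Subtype.val hx
      rwa [hg] at h
    · rintro ⟨y, rfl⟩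
      apply Subtype.ext
      rw [hg, Submodule.subtype_apply]
      exact (mem_torsionBy_iff _ _).1 y.2
  have h1 := Module.length_eq_add_of_exact (torsionBy R X ϖ).subtype g
    (Submodule.subtype_injective _) hgsurj hexact
  have h2 := Module.length_eq_add_of_exact (ϖ • (⊤ : Submodule R X)).subtype
    (ϖ • (⊤ : Submodule R X)).mkQ (Submodule.subtype_injective _) (Submodule.mkQ_surjective _)
    (LinearMap.exact_subtype_mkQ _)
  have hfin : Module.length R ↥(ϖ • (⊤ : Submodule R X)) ≠ ⊤ :=
    ne_top_of_le_ne_top hX (Module.length_le_of_injective _ (Submodule.subtype_injective _))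
  apply ENat.add_left_injective_of_ne_top hfin
  change Module.length R ↥(torsionBy R X ϖ) + Module.length R ↥(ϖ • (⊤ : Submodule R X)) =
    Module.length R (X ⧸ ϖ • (⊤ : Submodule R X)) + Module.length R ↥(ϖ • (⊤ : Submodule R X))
  rw [← h1, add_comm, ← h2]

end CommRing

/-! ### §2 Socle orthogonality over a discrete valuation ring -/

section DVR

variable {R : Type u} [CommRing R] [IsDomain R] [IsDiscreteValuationRing R] {ϖ : R}
  {N : Type v} [AddCommGroup N] [Module R N]

/-- A finitely generated module over a discrete valuation ring killed by a power of the uniformiser has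
finite length (`ℓ(Π R/(ϖ^{λᵢ})) = Σ λᵢ`, Macdonald's type; `ℓ(R/(ϖ^λ)) = λ` is Mathlib's `Ring.ord_pow`).
[cite: Kaplansky1954, §11 (PDF p. 29)] -/
theorem length_ne_top_of_pow_smul_eq_zero (hϖ : Irreducible ϖ) [Module.Finite R N] {k : ℕ}
    (hk : ∀ x : N, ϖ ^ k • x = 0) : Module.length R N ≠ ⊤ := by
  have hNt : Module.IsTorsion R N := fun x =>
    ⟨⟨ϖ ^ k, mem_nonZeroDivisors_of_ne_zero (pow_ne_zero _ hϖ.ne_zero)⟩, hk x⟩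
  obtain ⟨m, lam, -, -, ⟨e⟩⟩ := exists_linearEquiv_pi_quotient_uniformizer_pow_of_isTorsion hϖ N hNt
  rw [e.length_eq, Module.length_pi_of_fintype]
  refine ne_of_lt (WithTop.sum_lt_top.2 fun i _ => ?_)
  change Ring.ord R (ϖ ^ lam i) < ⊤
  rw [Ring.ord_pow (mem_nonZeroDivisors_of_ne_zero hϖ.ne_zero), Ring.ord_of_irreducible hϖ]
  simp

/-- **Socle orthogonality.** Let `R` be a DVR with uniformiser `ϖ`, `N` finitely generated with `ϖᵏN = 0`,
`P` an `R`-module whose `ϖ`-torsion is cyclic, and `B : N × N → P` an `R`-bilinear ALTERNATING form with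
trivial radical (`(∀ x, B(x, y) = 0) → y = 0`). Then for every `j` and every `w ∈ N`:
`B(v, w) = 0` for all `v ∈ ϖʲN` with `ϖv = 0` **iff** `w ∈ N[ϖʲ] + ϖN` — the orthogonal of the `j`-th
Ulm–Kaplansky socle `P_j = ϖʲN ∩ N[ϖ]` is `N[ϖʲ] + ϖN` (for `j = 0`: `N[ϖ]^⟂ = ϖN`). Proof: the induced
pairing `P_j × N/(N[ϖʲ]+ϖN) → P[ϖ] ≅ R/(ϖ)` of `R/(ϖ)`-vector spaces has trivial left kernel, and both
spaces have dimension `ℓ(ϖʲN/ϖ^{j+1}N)` (§1), hence trivial right kernel. This is the step that turns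
Howard's single «non-degenerate, alternating, `R`-bilinear, `R`-valued pairing» of Lemma 1.5.7 into the
layered pairings of Thm. 1.4.2. [cite: Howard2004HeegnerKolyvagin, Lemma 1.5.7, proof (arXiv:1202.6340 Lemma 2.5.7, p0010 L110–L134)] -/
theorem forall_socle_apply_eq_zero_iff (hϖ : Irreducible ϖ) [Module.Finite R N] {k : ℕ}
    (hk : ∀ x : N, ϖ ^ k • x = 0)
    {P : Type*} [AddCommGroup P] [Module R P]
    (hP : ∀ p q : P, ϖ • p = 0 → ϖ • q = 0 → p ≠ 0 → ∃ r : R, q = r • p)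
    (B : N →ₗ[R] N →ₗ[R] P) (halt : ∀ x, B x x = 0) (hnd : ∀ y, (∀ x, B x y = 0) → y = 0)
    (j : ℕ) (w : N) :
    (∀ v : N, v ∈ ϖ ^ j • (⊤ : Submodule R N) → ϖ • v = 0 → B v w = 0) ↔
      w ∈ torsionBy R N (ϖ ^ j) ⊔ ϖ • (⊤ : Submodule R N) := by
  classical
  have hskew : ∀ x y, B x y = -B y x := fun x y => by
    have h := halt (x + y)
    simp only [map_add, LinearMap.add_apply, halt, zero_add, add_zero] at h
    exact eq_neg_of_add_eq_zero_right h
  have hndl : ∀ x, (∀ y, B x y = 0) → x = 0 := fun x hx =>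
    hnd x fun y => by rw [hskew, hx y, neg_zero]
  have hB1 : ∀ (c : R) (x y : N), B (c • x) y = c • B x y := fun c x y => by
    rw [LinearMap.map_smul, LinearMap.smul_apply]
  have hB2 : ∀ (c : R) (x y : N), B x (c • y) = c • B x y := fun c x y => LinearMap.map_smul (B x) c y
  -- the easy direction
  have heasy : ∀ w, w ∈ torsionBy R N (ϖ ^ j) ⊔ ϖ • (⊤ : Submodule R N) →
      ∀ v : N, v ∈ ϖ ^ j • (⊤ : Submodule R N) → ϖ • v = 0 → B v w = 0 := by
    intro w hw v hv hv0
    obtain ⟨a, ha, b, hb, rfl⟩ := Submodule.mem_sup.1 hw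
    obtain ⟨u, -, rfl⟩ := (Submodule.mem_smul_pointwise_iff_exists _ _ _).1 hb
    obtain ⟨v', -, rfl⟩ := (Submodule.mem_smul_pointwise_iff_exists _ _ _).1 hv
    have t1 : B (ϖ ^ j • v') a = 0 := by
      rw [hB1, ← hB2, (mem_torsionBy_iff _ _).1 ha, map_zero]
    have t2 : B (ϖ ^ j • v') (ϖ • u) = 0 := by
      rw [hB2, ← hB1, hv0, map_zero, LinearMap.zero_apply]
    rw [map_add, t1, t2, add_zero]
  refine ⟨fun hw => ?_, heasy w⟩
  -- notation: `X = ϖʲN`, `V = X[ϖ]`, `K = N[ϖʲ] + ϖN`, `W = N/K`, `F = R/(ϖ)`, `L = P[ϖ]`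
  haveI : Ideal.IsMaximal (Ideal.span {ϖ}) := PrincipalIdealRing.isMaximal_of_irreducible hϖ
  letI : Field (R ⧸ Ideal.span {ϖ}) := Ideal.Quotient.field (Ideal.span {ϖ})
  haveI : IsNoetherian R N := isNoetherian_of_isNoetherianRing_of_finite R N
  set X : Submodule R N := ϖ ^ j • (⊤ : Submodule R N) with hX
  set K : Submodule R N := torsionBy R N (ϖ ^ j) ⊔ ϖ • (⊤ : Submodule R N) with hK
  have hKϖ : ∀ x : N, ϖ • x ∈ K := fun x =>
    Submodule.mem_sup_right (Submodule.smul_mem_pointwise_smul _ _ _ Submodule.mem_top)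
  have hW' : Module.IsTorsionBySet R (N ⧸ K) (Ideal.span {ϖ}) := by
    rintro z ⟨r, hr⟩
    obtain ⟨a, rfl⟩ := Ideal.mem_span_singleton'.1 hr
    obtain ⟨x, rfl⟩ := Submodule.Quotient.mk_surjective K z
    change (a * ϖ) • Submodule.Quotient.mk x = 0
    rw [← Submodule.Quotient.mk_smul, Submodule.Quotient.mk_eq_zero, mul_smul]
    exact K.smul_mem a (hKϖ x)
  letI : Module (R ⧸ Ideal.span {ϖ}) (N ⧸ K) := hW'.module
  haveI : IsScalarTower R (R ⧸ Ideal.span {ϖ}) (N ⧸ K) := hW'.isScalarTower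
  haveI : Module.Finite (R ⧸ Ideal.span {ϖ}) (N ⧸ K) :=
    Module.Finite.of_restrictScalars_finite R _ _
  haveI : Module.Finite (R ⧸ Ideal.span {ϖ}) ↥(torsionBy R ↥X ϖ) :=
    Module.Finite.of_restrictScalars_finite R _ _
  -- equal dimensions: both have the length of `X/ϖX`
  have hlenN : Module.length R N ≠ ⊤ := length_ne_top_of_pow_smul_eq_zero hϖ hk
  have hlenX : Module.length R ↥X ≠ ⊤ :=
    ne_top_of_le_ne_top hlenN (Module.length_le_of_injective _ (Submodule.subtype_injective X))
  obtain ⟨eW⟩ := nonempty_quotient_torsionBy_sup_smul_top_linearEquiv (N := N) ϖ j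
  have hdim : Module.finrank (R ⧸ Ideal.span {ϖ}) ↥(torsionBy R ↥X ϖ) =
      Module.finrank (R ⧸ Ideal.span {ϖ}) (N ⧸ K) := by
    have h1 : Module.length R ↥(torsionBy R ↥X ϖ) = Module.length R (N ⧸ K) := by
      rw [length_torsionBy_eq_length_quotient_smul_top ϖ hlenX, ← eW.length_eq]
    rw [Module.length_eq_of_surjective (S := R) (R := R ⧸ Ideal.span {ϖ})
        (M := ↥(torsionBy R ↥X ϖ)) Ideal.Quotient.mk_surjective,
      Module.length_eq_of_surjective (S := R) (R := R ⧸ Ideal.span {ϖ})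
        (M := N ⧸ K) Ideal.Quotient.mk_surjective,
      Module.length_eq_finrank, Module.length_eq_finrank] at h1
    exact_mod_cast h1
  -- values `B v w`, `v ∈ V`, lie in `L = P[ϖ]`; the value line
  have hvX : ∀ v : ↥(torsionBy R ↥X ϖ), ϖ • ((v : ↥X) : N) = 0 := fun v => by
    rw [← Submodule.coe_smul, (mem_torsionBy_iff _ _).1 v.2, Submodule.coe_zero]
  have hval : ∀ (v : ↥(torsionBy R ↥X ϖ)) (w : N), B ((v : ↥X) : N) w ∈ torsionBy R P ϖ := by
    intro v w
    rw [mem_torsionBy_iff, ← hB1, hvX v, map_zero, LinearMap.zero_apply]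
  have hvalK : ∀ (v : ↥(torsionBy R ↥X ϖ)), ∀ w ∈ K, B ((v : ↥X) : N) w = 0 :=
    fun v w hwK => heasy w hwK _ (v : ↥X).2 (hvX v)
  by_cases hP0 : ∀ p : P, ϖ • p = 0 → p = 0
  · -- `P[ϖ] = 0`: then `V = 0`, so `W = 0`, so `w ∈ K`
    have hV : ∀ v : ↥(torsionBy R ↥X ϖ), v = 0 := fun v => by
      have h : ((v : ↥X) : N) = 0 :=
        hndl _ fun y => hP0 _ ((mem_torsionBy_iff _ _).1 (hval v y))
      exact Subtype.ext (Subtype.ext h)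
    haveI : Subsingleton ↥(torsionBy R ↥X ϖ) := ⟨fun a b => by rw [hV a, hV b]⟩
    have h0 : Module.finrank (R ⧸ Ideal.span {ϖ}) (N ⧸ K) = 0 := by
      rw [← hdim, Module.finrank_zero_of_subsingleton]
    haveI : Subsingleton (N ⧸ K) := by
      rw [← Module.finrank_zero_iff (R := R ⧸ Ideal.span {ϖ})]
      exact h0
    have : (Submodule.Quotient.mk w : N ⧸ K) = 0 := Subsingleton.elim _ _
    exact (Submodule.Quotient.mk_eq_zero K).1 this
  · -- a generator `p₀` of the line `P[ϖ]`
    push Not at hP0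
    obtain ⟨p₀, hp₀, hp₀0⟩ := hP0
    let ι : (R ⧸ Ideal.span {ϖ}) →ₗ[R ⧸ Ideal.span {ϖ}] ↥(torsionBy R P ϖ) :=
      LinearMap.toSpanSingleton _ _ ⟨p₀, (mem_torsionBy_iff _ _).2 hp₀⟩
    have hι : Function.Bijective ι := by
      constructor
      · rw [← LinearMap.ker_eq_bot, LinearMap.ker_toSpanSingleton]
        exact fun h => hp₀0 (congrArg Subtype.val h)
      · intro q
        obtain ⟨r, hr⟩ := hP p₀ q hp₀ ((mem_torsionBy_iff _ _).1 q.2) hp₀0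
        refine ⟨Ideal.Quotient.mk _ r, Subtype.ext ?_⟩
        change (((Ideal.Quotient.mk (Ideal.span {ϖ}) r) • (⟨p₀, _⟩ : ↥(torsionBy R P ϖ)) :
          ↥(torsionBy R P ϖ)) : P) = q
        rw [Submodule.torsionBy.mk_ideal_smul, Submodule.coe_smul, hr]
    let e₀ := LinearEquiv.ofBijective ι hι
    -- the induced `F`-bilinear form `β : V × W → F`
    have hcompat : ∀ v : ↥(torsionBy R ↥X ϖ), K ≤ LinearMap.ker
        (LinearMap.codRestrict (torsionBy R P ϖ) (B ((v : ↥X) : N)) (hval v)) := fun v x hx => by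
      rw [LinearMap.mem_ker]
      exact Subtype.ext (hvalK v x hx)
    let f : ↥(torsionBy R ↥X ϖ) → (N ⧸ K) →ₗ[R] ↥(torsionBy R P ϖ) := fun v =>
      K.liftQ (LinearMap.codRestrict (torsionBy R P ϖ) (B ((v : ↥X) : N)) (hval v)) (hcompat v)
    have hf : ∀ v x, f v (Submodule.Quotient.mk x) = ⟨B ((v : ↥X) : N) x, hval v x⟩ := fun v x => rfl
    let βL : ↥(torsionBy R ↥X ϖ) →ₗ[R ⧸ Ideal.span {ϖ}] (N ⧸ K) →ₗ[R ⧸ Ideal.span {ϖ}]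
        ↥(torsionBy R P ϖ) :=
      LinearMap.mk₂ (R ⧸ Ideal.span {ϖ}) (fun v z => f v z)
        (fun v v' z => by
          obtain ⟨x, rfl⟩ := Submodule.Quotient.mk_surjective K z
          simp only [hf]
          exact Subtype.ext (by simp))
        (fun c v z => by
          obtain ⟨r, rfl⟩ := Ideal.Quotient.mk_surjective c
          obtain ⟨x, rfl⟩ := Submodule.Quotient.mk_surjective K z
          rw [Submodule.torsionBy.mk_ideal_smul, Submodule.torsionBy.mk_ideal_smul, hf, hf]
          exact Subtype.ext (by simp))
        (fun v z z' => by rw [map_add])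
        (fun c v z => by
          obtain ⟨r, rfl⟩ := Ideal.Quotient.mk_surjective c
          obtain ⟨x, rfl⟩ := Submodule.Quotient.mk_surjective K z
          have h1 : (Ideal.Quotient.mk (Ideal.span {ϖ}) r) • (Submodule.Quotient.mk x : N ⧸ K) =
              Submodule.Quotient.mk (r • x) := rfl
          rw [h1, Submodule.torsionBy.mk_ideal_smul, hf, hf]
          exact Subtype.ext (by simp))
    have hβL : ∀ v x, βL v (Submodule.Quotient.mk x) = ⟨B ((v : ↥X) : N) x, hval v x⟩ :=
      fun v x => rfl
    let β : ↥(torsionBy R ↥X ϖ) →ₗ[R ⧸ Ideal.span {ϖ}] (N ⧸ K) →ₗ[R ⧸ Ideal.span {ϖ}]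
        (R ⧸ Ideal.span {ϖ}) := βL.compr₂ e₀.symm.toLinearMap
    have hβ : ∀ v x, β v (Submodule.Quotient.mk x) = e₀.symm ⟨B ((v : ↥X) : N) x, hval v x⟩ :=
      fun v x => rfl
    have hsep : β.SeparatingLeft := by
      intro v hv
      have h : ((v : ↥X) : N) = 0 := hndl _ fun y => by
        have h1 := hv (Submodule.Quotient.mk y)
        rw [hβ, LinearEquiv.map_eq_zero_iff] at h1
        exact congrArg Subtype.val h1
      exact Subtype.ext (Subtype.ext h)
    have hsepR := Literature.GroupTheory.FiniteAbelian.separatingRight_of_separatingLeft_of_finrank_eq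
      β hsep hdim
    have hmk : (Submodule.Quotient.mk w : N ⧸ K) = 0 := hsepR _ fun v => by
      rw [hβ, LinearEquiv.map_eq_zero_iff]
      refine Subtype.ext ?_
      change B ((v : ↥X) : N) w = 0
      exact hw _ (v : ↥X).2 (hvX v)
    exact (Submodule.Quotient.mk_eq_zero K).1 hmk

/-! ### §3 The symplectic structure theorem («`≅ D ⊕ D`», Howard Lemma 1.5.7) -/

/-- **Symplectic torsion modules over a DVR are `M ⊕ M` (Howard 2004, Lemma 1.5.7: «we now have that
`𝓗^ℓ(n)/(𝓗(n)+𝓗(ℓn)) ≅ D ⊕ D` for some `R`-module `D`»).** Let `R` be a discrete valuation ring with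
uniformiser `ϖ`, `N` a finitely generated `R`-module with `ϖᵏN = 0` (a module over Howard's principal Artinian
`R/𝔪ᵏ`), `P` an `R`-module whose `ϖ`-torsion is cyclic (`P = R/𝔪ᵏ` for Howard's «`R`-valued»), and
`B : N × N → P` an `R`-bilinear ALTERNATING form with trivial radical. Then
`N ≃ₗ[R] (Π_j R/(ϖ^{n_j})) × (Π_j R/(ϖ^{n_j}))` with `1 ≤ n_j ≤ k`. Proof: the layered forms
`B_t(x, y) = B(ϖᵗx, y)` on `N[ϖ^{t+1}]` are alternating with radical `N[ϖᵗ] + ϖN[ϖ^{t+2}]`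
(`forall_socle_apply_eq_zero_iff`), so x10b-p1-w7's algebraic half of Thm. 1.4.2
(`exists_linearEquiv_pi_prod_pi_prod_self_of_isAlt`, with `k + 1`) gives `N ≅ (R/(ϖ^{k+1}))^ε ⊕ M ⊕ M`, and
`ϖᵏN = 0` kills the free part (`ε = 0`) and bounds the exponents. The remark «`D` is cyclic» (two
generators) is not included. [cite: Howard2004HeegnerKolyvagin, Lemma 1.5.7 (arXiv:1202.6340 Lemma 2.5.7, p0010 L105–L139)] -/
theorem exists_linearEquiv_pi_prod_self_of_isAlt_of_nondegenerate (hϖ : Irreducible ϖ)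
    [Module.Finite R N] {k : ℕ} (hk : ∀ x : N, ϖ ^ k • x = 0)
    {P : Type*} [AddCommGroup P] [Module R P]
    (hP : ∀ p q : P, ϖ • p = 0 → ϖ • q = 0 → p ≠ 0 → ∃ r : R, q = r • p)
    (B : N →ₗ[R] N →ₗ[R] P) (halt : ∀ x, B x x = 0) (hnd : ∀ y, (∀ x, B x y = 0) → y = 0) :
    ∃ (m : ℕ) (n : Fin m → ℕ), (∀ j, 1 ≤ n j ∧ n j ≤ k) ∧
      Nonempty (N ≃ₗ[R] (Π j, R ⧸ Ideal.span {ϖ ^ n j}) × (Π j, R ⧸ Ideal.span {ϖ ^ n j})) := by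
  classical
  have hskew : ∀ x y, B x y = -B y x := fun x y => by
    have h := halt (x + y)
    simp only [map_add, LinearMap.add_apply, halt, zero_add, add_zero] at h
    exact eq_neg_of_add_eq_zero_right h
  have hB1 : ∀ (c : R) (x y : N), B (c • x) y = c • B x y := fun c x y => by
    rw [LinearMap.map_smul, LinearMap.smul_apply]
  have hB2 : ∀ (c : R) (x y : N), B x (c • y) = c • B x y := fun c x y => LinearMap.map_smul (B x) c y
  -- the induced layer forms `B'_t(x, y) = B(ϖᵗ x, y)` on `N[ϖ^{t+1}]`
  let B' : ∀ t : ℕ, ↥(torsionBy R N (ϖ ^ (t + 1))) →ₗ[R] ↥(torsionBy R N (ϖ ^ (t + 1))) →ₗ[R] P :=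
    fun t => (B.comp ((DistribSMul.toLinearMap R N (ϖ ^ t)).comp
      (torsionBy R N (ϖ ^ (t + 1))).subtype)).compl₂ (torsionBy R N (ϖ ^ (t + 1))).subtype
  have hB' : ∀ t (x y : ↥(torsionBy R N (ϖ ^ (t + 1)))), B' t x y = B (ϖ ^ t • (x : N)) (y : N) :=
    fun t x y => rfl
  have halt' : ∀ t, t + 1 < k + 1 → ∀ x, B' t x x = 0 := fun t _ x => by
    rw [hB', hB1, halt, smul_zero]
  have hker' : ∀ t, t + 1 < k + 1 → ∀ x : ↥(torsionBy R N (ϖ ^ (t + 1))), (∀ y, B' t x y = 0) ↔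
      (x : N) ∈ torsionBy R N (ϖ ^ t) ⊔ ϖ • torsionBy R N (ϖ ^ (t + 2)) := by
    intro t _ x
    constructor
    · intro hx
      -- `x` is orthogonal to the socle `ϖᵗN ∩ N[ϖ]`
      have h1 : ∀ v : N, v ∈ ϖ ^ t • (⊤ : Submodule R N) → ϖ • v = 0 → B v (x : N) = 0 := by
        intro v hv hv0
        obtain ⟨y, -, rfl⟩ := (Submodule.mem_smul_pointwise_iff_exists _ _ _).1 hv
        have hy : y ∈ torsionBy R N (ϖ ^ (t + 1)) := by
          rw [mem_torsionBy_iff, pow_succ', mul_smul, hv0]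
        have h := hx ⟨y, hy⟩
        rw [hB'] at h
        rw [hB1, hskew, smul_neg, ← hB1, h, neg_zero]
      have h2 := (forall_socle_apply_eq_zero_iff hϖ hk hP B halt hnd t (x : N)).1 h1
      obtain ⟨a, ha, b, hb, hab⟩ := Submodule.mem_sup.1 h2
      obtain ⟨u, -, rfl⟩ := (Submodule.mem_smul_pointwise_iff_exists _ _ _).1 hb
      have hu : u ∈ torsionBy R N (ϖ ^ (t + 2)) := by
        have hxa : ϖ • u = (x : N) - a := by rw [← hab]; abel
        rw [mem_torsionBy_iff, pow_succ, mul_smul, hxa, smul_sub, (mem_torsionBy_iff _ _).1 x.2,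
          pow_succ', mul_smul, (mem_torsionBy_iff _ _).1 ha, smul_zero, sub_zero]
      rw [← hab]
      exact Submodule.add_mem_sup ha (Submodule.smul_mem_pointwise_smul _ _ _ hu)
    · intro hx y
      obtain ⟨a, ha, b, hb, hab⟩ := Submodule.mem_sup.1 hx
      obtain ⟨u, -, rfl⟩ := (Submodule.mem_smul_pointwise_iff_exists _ _ _).1 hb
      rw [hB', ← hab, smul_add, (mem_torsionBy_iff _ _).1 ha, zero_add, smul_smul, ← pow_succ, hB1,
        ← hB2, (mem_torsionBy_iff _ _).1 y.2, map_zero]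
  -- Thm. 1.4.2's algebraic half with `k + 1`: `N ≅ (R/ϖ^{k+1})^ε × M × M`
  have hk' : ∀ x : N, ϖ ^ (k + 1) • x = 0 := fun x => by
    rw [pow_succ, mul_smul]
    exact hk _
  obtain ⟨ε, m, n, hε, hn, ⟨e⟩⟩ := exists_linearEquiv_pi_prod_pi_prod_self_of_isAlt hϖ hk'
    (P := fun _ => P) (fun _ => hP) B' halt' hker'
  -- no summand `R/ϖ^{k+1}` survives `ϖᵏ N = 0`: `ε = 0` and `n_j ≤ k`
  have hquot : ∀ {a : ℕ}, (ϖ ^ k • (1 : R ⧸ Ideal.span {ϖ ^ a}) = 0) → a ≤ k := fun {a} h => by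
    rw [Algebra.smul_def, mul_one, Ideal.Quotient.algebraMap_eq, Ideal.Quotient.eq_zero_iff_mem,
      Ideal.mem_span_singleton] at h
    exact (pow_dvd_pow_iff hϖ.ne_zero hϖ.not_isUnit).1 h
  have hε0 : ε = 0 := by
    by_contra hne
    obtain rfl : ε = 1 := by omega
    have h := hk (e.symm (fun _ => 1, 0))
    rw [← map_smul, e.symm.map_eq_zero_iff, Prod.smul_mk, smul_zero, Prod.mk_eq_zero] at h
    have h1 := congrFun h.1 0
    rw [Pi.smul_apply, Pi.zero_apply] at h1
    exact absurd (hquot h1) (by omega)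
  subst hε0
  have hnk : ∀ j, n j ≤ k := fun j => by
    have h := hk (e.symm (0, (Pi.single j 1, 0)))
    rw [← map_smul, e.symm.map_eq_zero_iff, Prod.smul_mk, smul_zero, Prod.smul_mk, smul_zero,
      Prod.mk_eq_zero, Prod.mk_eq_zero] at h
    have h1 := congrFun h.2.1 j
    rw [Pi.smul_apply, Pi.single_eq_same, Pi.zero_apply] at h1
    exact hquot h1
  haveI : Unique (Fin 0 → R ⧸ Ideal.span {ϖ ^ (k + 1)}) := Pi.uniqueOfIsEmpty _
  exact ⟨m, n, fun j => ⟨(hn j).1, hnk j⟩, ⟨e.trans (LinearEquiv.uniqueProd :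
    ((Fin 0 → R ⧸ Ideal.span {ϖ ^ (k + 1)}) × ((Π j, R ⧸ Ideal.span {ϖ ^ n j}) ×
      (Π j, R ⧸ Ideal.span {ϖ ^ n j}))) ≃ₗ[R] _)⟩⟩

/-- Howard's case of the symplectic structure theorem: the values are in `R^{(a)} = R/(ϖᵃ)` («`R`-valued» for
the principal Artinian `R` of §1.5), whose `ϖ`-torsion is a line
(`exists_eq_smul_of_smul_eq_zero_quotient_uniformizer_pow`). [cite: Howard2004HeegnerKolyvagin, Lemma 1.5.7 (arXiv:1202.6340 Lemma 2.5.7, p0010 L110–L134)] -/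
theorem exists_linearEquiv_pi_prod_self_of_isAlt_quotient_uniformizer_pow (hϖ : Irreducible ϖ)
    [Module.Finite R N] {k : ℕ} (hk : ∀ x : N, ϖ ^ k • x = 0) {a : ℕ}
    (B : N →ₗ[R] N →ₗ[R] R ⧸ Ideal.span {ϖ ^ a}) (halt : ∀ x, B x x = 0)
    (hnd : ∀ y, (∀ x, B x y = 0) → y = 0) :
    ∃ (m : ℕ) (n : Fin m → ℕ), (∀ j, 1 ≤ n j ∧ n j ≤ k) ∧
      Nonempty (N ≃ₗ[R] (Π j, R ⧸ Ideal.span {ϖ ^ n j}) × (Π j, R ⧸ Ideal.span {ϖ ^ n j})) :=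
  exists_linearEquiv_pi_prod_self_of_isAlt_of_nondegenerate hϖ hk
    (exists_eq_smul_of_smul_eq_zero_quotient_uniformizer_pow hϖ a) B halt hnd

/-- «`≅ D ⊕ D` for some `R`-module `D`»: under the hypotheses of
`exists_linearEquiv_pi_prod_self_of_isAlt_of_nondegenerate` there is an `R`-module `M` with `N ≅ M × M`, and in
particular `ℓ(N) = 2ℓ(M)` is even. [cite: Howard2004HeegnerKolyvagin, Lemma 1.5.7 (arXiv:1202.6340 Lemma 2.5.7, p0010 L134)] -/
theorem even_length_of_isAlt_of_nondegenerate (hϖ : Irreducible ϖ)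
    [Module.Finite R N] {k : ℕ} (hk : ∀ x : N, ϖ ^ k • x = 0)
    {P : Type*} [AddCommGroup P] [Module R P]
    (hP : ∀ p q : P, ϖ • p = 0 → ϖ • q = 0 → p ≠ 0 → ∃ r : R, q = r • p)
    (B : N →ₗ[R] N →ₗ[R] P) (halt : ∀ x, B x x = 0) (hnd : ∀ y, (∀ x, B x y = 0) → y = 0) :
    ∃ M : Type u, ∃ (_ : AddCommGroup M) (_ : Module R M),
      Nonempty (N ≃ₗ[R] M × M) ∧ Module.length R N = 2 * Module.length R M := by
  obtain ⟨m, n, -, ⟨e⟩⟩ := exists_linearEquiv_pi_prod_self_of_isAlt_of_nondegenerate hϖ hk hP B halt hnd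
  exact ⟨_, inferInstance, inferInstance, ⟨e⟩, by rw [e.length_eq, Module.length_prod, two_mul]⟩

/-! ### §4 Howard's printed conclusion for a two-generated module: `≅ (R/𝔪^δ)²` -/

/-- **Howard 2004, Lemma 1.5.7, the printed conclusion «`𝓗^ℓ(n)/(𝓗(n)+𝓗(ℓn)) ≅ (R/𝔪^δ)²`».** If, in
the situation of `exists_linearEquiv_pi_prod_self_of_isAlt_of_nondegenerate` (DVR `R`, uniformiser `ϖ`,
`N` finitely generated with `ϖᵏN = 0`, a non-degenerate alternating form with values in a module with cyclic
`ϖ`-torsion), the module `N` «can be generated by two elements» (`span {x, y} = ⊤`), then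
`N ≃ₗ[R] (R/(ϖ^δ)) × (R/(ϖ^δ))` for some `δ ≤ k` («Since `𝓗^ℓ(n)/𝓗(n)` injects into `H¹_s(K_ℓ, T)` which is
free of rank 2, it follows that […] can be generated by two elements. Therefore `D` is cyclic»). Proof:
`N ≅ (Π_{j<m} R/(ϖ^{n_j}))²` with `n_j ≥ 1` gives `ℓ(N[ϖ]) = 2m`, while `ℓ(N[ϖ]) = ℓ(N/ϖN) ≤ ℓ((R/(ϖ))²) = 2`
because `N/ϖN` is a quotient of `(R/(ϖ))²`; so `m ≤ 1`. [cite: Howard2004HeegnerKolyvagin, Lemma 1.5.7 (arXiv:1202.6340 Lemma 2.5.7, p0010 L105–L139)] -/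
theorem exists_linearEquiv_quotient_pow_prod_self_of_isAlt_of_span_pair (hϖ : Irreducible ϖ)
    [Module.Finite R N] {k : ℕ} (hk : ∀ x : N, ϖ ^ k • x = 0)
    {P : Type*} [AddCommGroup P] [Module R P]
    (hP : ∀ p q : P, ϖ • p = 0 → ϖ • q = 0 → p ≠ 0 → ∃ r : R, q = r • p)
    (B : N →ₗ[R] N →ₗ[R] P) (halt : ∀ x, B x x = 0) (hnd : ∀ y, (∀ x, B x y = 0) → y = 0)
    (x y : N) (hxy : Submodule.span R {x, y} = ⊤) :
    ∃ δ : ℕ, δ ≤ k ∧ Nonempty (N ≃ₗ[R] (R ⧸ Ideal.span {ϖ ^ δ}) × (R ⧸ Ideal.span {ϖ ^ δ})) := by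
  classical
  obtain ⟨m, n, hn, ⟨e⟩⟩ := exists_linearEquiv_pi_prod_self_of_isAlt_of_nondegenerate hϖ hk hP B halt hnd
  haveI : Ideal.IsMaximal (R ∙ ϖ) := PrincipalIdealRing.isMaximal_of_irreducible hϖ
  letI : Field (R ⧸ R ∙ ϖ) := Ideal.Quotient.field (R ∙ ϖ)
  have hp : Prime ϖ := hϖ.prime
  -- `ℓ(N[ϖ]) = 2m`
  haveI := finite_torsionBy (M := N) ϖ
  have h1 : Module.finrank (R ⧸ R ∙ ϖ) (torsionBy R N ϖ) = 2 * m := by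
    rw [finrank_torsionBy_eq_of_linearEquiv e ϖ, finrank_torsionBy_prod hp, finrank_torsionBy_pi hp,
      Finset.sum_congr rfl fun j _ => ?_, Finset.sum_const, Finset.card_univ, Fintype.card_fin,
      smul_eq_mul, mul_one, two_mul]
    obtain ⟨c, hc⟩ : ∃ c, n j = c + 1 := ⟨n j - 1, by have := (hn j).1; omega⟩
    rw [hc]
    exact finrank_torsionBy_quotient_uniformizer_pow_succ hϖ c
  have h2 : Module.length R (torsionBy R N ϖ) = (2 * m : ℕ) := by
    rw [Module.length_eq_of_surjective (S := R) (R := R ⧸ R ∙ ϖ) (M := ↥(torsionBy R N ϖ))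
      Ideal.Quotient.mk_surjective, Module.length_eq_finrank, h1]
  -- `ℓ(N/ϖN) ≤ 2`: `N/ϖN` is a quotient of `(R/(ϖ))²`
  have h3 : Module.length R (N ⧸ (ϖ • (⊤ : Submodule R N))) ≤ 2 := by
    have hker : ∀ z : N, Ideal.span {ϖ} ≤ LinearMap.ker
        ((ϖ • (⊤ : Submodule R N)).mkQ.comp (LinearMap.toSpanSingleton R N z)) := by
      intro z r hr
      obtain ⟨a, rfl⟩ := Ideal.mem_span_singleton'.1 hr
      rw [LinearMap.mem_ker, LinearMap.comp_apply, LinearMap.toSpanSingleton_apply, Submodule.mkQ_apply,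
        Submodule.Quotient.mk_eq_zero, mul_smul]
      exact Submodule.smul_mem _ a (Submodule.smul_mem_pointwise_smul _ _ _ Submodule.mem_top)
    let g : (R ⧸ Ideal.span {ϖ}) × (R ⧸ Ideal.span {ϖ}) →ₗ[R] N ⧸ (ϖ • (⊤ : Submodule R N)) :=
      LinearMap.coprod ((Ideal.span {ϖ}).liftQ _ (hker x)) ((Ideal.span {ϖ}).liftQ _ (hker y))
    have hg : Function.Surjective g := by
      intro z
      obtain ⟨w, rfl⟩ := Submodule.Quotient.mk_surjective _ z
      have hw : w ∈ Submodule.span R {x, y} := by rw [hxy]; exact Submodule.mem_top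
      obtain ⟨a, b, rfl⟩ := Submodule.mem_span_pair.1 hw
      refine ⟨(Ideal.Quotient.mk _ a, Ideal.Quotient.mk _ b), ?_⟩
      simp only [g, LinearMap.coprod_apply]
      rfl
    refine (Module.length_le_of_surjective g hg).trans ?_
    rw [Module.length_prod]
    change Ring.ord R ϖ + Ring.ord R ϖ ≤ 2
    rw [Ring.ord_of_irreducible hϖ]
    rfl
  have hm : m ≤ 1 := by
    have h := length_torsionBy_eq_length_quotient_smul_top (X := N) ϖ
      (length_ne_top_of_pow_smul_eq_zero hϖ hk)
    rw [h2] at h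
    rw [← h] at h3
    have : (2 * m : ℕ) ≤ 2 := by exact_mod_cast h3
    omega
  interval_cases m
  · -- `N = 0 ≅ (R/(ϖ⁰))²`
    haveI : Subsingleton N := e.toEquiv.subsingleton
    have htop : Ideal.span {(ϖ ^ 0 : R)} = ⊤ := by rw [pow_zero, Ideal.span_singleton_one]
    haveI : Subsingleton (R ⧸ Ideal.span {ϖ ^ 0}) := Ideal.Quotient.subsingleton_iff.2 htop
    exact ⟨0, Nat.zero_le _, ⟨LinearEquiv.ofSubsingleton _ _⟩⟩
  · refine ⟨n 0, (hn 0).2, ⟨e.trans (LinearEquiv.prodCongr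
      (LinearEquiv.piUnique R fun j : Fin 1 => R ⧸ Ideal.span {ϖ ^ n j})
      (LinearEquiv.piUnique R fun j : Fin 1 => R ⧸ Ideal.span {ϖ ^ n j}))⟩⟩

end DVR

end Literature.Algebra.Module

end
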